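import Summits.NavierStokesRegularity.NavierStokesRegularity.Theorems.ArgmaxNearDoorsCompositions
import HarnessLib

/-!
# ArgmaxNearDoorsCompositionsShrinking — S36 §A «ArgmaxNearDoors»: the composition of door C♯ (§5, second half)
# and §6 (D♭ by name; the doors modulo the engine plates) — plate P0-36A part 3 of 3, VERBATIM from the sketch

LANDING NOTE: `HOME/ns-regularity-ideate-p1/r34/Sketch36A.lean` sha16 3ebc53b38700dd90, lines 418–582 byte-identical
(LEAD S-door ns-s30-p1 g3). `--supports stmt-NavierStokesRegularity-0056 --as helper`.

## The sketch header (verbatim)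

The far field of the stretching rate at a vorticity argmax is PAID BY LERAY'S ENERGY INEQUALITY
(LEAD ns-s30-p1 g3, 16:11:15Z; tools `ArgmaxDoorsNearEngine` E♭/N♭, ns-sfl-p1 g5 `ArgmaxDoorsDepletionLocal` D♭):
with the local depletion split `⟪ω,(∇u)ω⟫(x̄) ≤ |ω(x̄)|²·(A·∫_{B(x̄,ρ)} |ω_⊥| |x̄−y|⁻³ + 8A'(4π/(3(ρ/2)³))^{1/2}‖ω(t)‖₂)`
and `∫‖ω(t)‖₂ dt ≤ √(T−t₁)·√(C‖u(0)‖²₂/ν)` on every end slab, door S35-C's ONE-POINT hypothesis loses its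
far field: only the NEAR-FIELD depletion integral around the argmax is charged.

* door S36-C♭ «ArgmaxNearCoherenceDoor» (fixed scale `R = r₀ > 0`, charged ball `B(x̄, 2R)` — the ball of
  D♭ `inner_stretching_le_local`): at every late CRITICAL argmax (`ε < (T−t)|ω(x̄,t)|`),
  `(T − t)·(A·∫_{B(x̄,2r₀)} |ω(y) − ⟪ω(y),ξ(x̄)⟫ξ(x̄)| |x̄−y|⁻³ dy − ν|∇ξ(x̄)|²_F) ≤ a` (`a < 1`) ⇒ continuation.
  CLOSES from D♭ (landed, by name) + E♭ + N♭ + F (composition below, kernel-checked).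
* door S36-C♯ «ArgmaxShrinkingCoherenceDoor» (scale `R = r₀(T−t)^β`, ball `B(x̄, 2R)`, `0 < β < 1/3` — the
  honest energy-class exponent: `∫^T (T−t)^{−3β} dt < ∞`): the same with the ball shrinking; plates E♭w (weighted
  engine) + N♭β (shrinking budget) — LEAD's `ArgmaxDoorsNearEngineWeighted`; composition kernel-checked.
* support `hasSobolevExtensionPast_of_barrier_family`: the common real-variable end of both doors.

HONEST LABEL: bookkeeping (variant / new-combination): CF93's depletion seen from ONE point (door S35-C) with the
far field removed by Cauchy–Schwarz + the energy inequality; near-field print = Constantin–Fefferman 1993 (Lipschitz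
coherence on the intense region), Grujić 2009 (localisation in a ball of fixed radius), Grujić–Ruzmaikina 2004.
WHAT THIS IS NOT: regularity CRITERIA about hypothetical blow-up; item 0056 `NoTypeII` / NS regularity NOT proved;
no Literature fact is a hypothesis; nothing here is a route or a summit statement (`--supports 0056 --as helper`).
-/

noncomputable section

open MeasureTheory Set Function Filter Metric Real InnerProductSpace
open _root_.Topology
open scoped ENNReal NNReal RealInnerProductSpace ContDiff
open Literature.Analysis Literature.Analysis.FluidPDE
open Literature.Analysis.FluidPDE.VorticityDirectionDynamics

set_option linter.dupNamespace false

namespace Summit.NavierStokesRegularity.NavierStokesRegularity.Theorems.ArgmaxDoors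

-- nested operator types (second derivatives)
set_option maxSynthPendingDepth 3

/-- **Door S36-C♯ from the plates**: `LocalDepletion → NearEngineWeighted → ShrinkingDissipationBudget →
TypeISmallFloor → ArgmaxShrinkingCoherenceDoor`. As for C♭ with the far-field coefficient
`k(s) = 8A'(4π/(3(r₀(T−s)^β)³))^{1/2}` (D♭ at `R = r₀(T−s)^β`), the weighted engine, and the shrinking budget
`∫_{t₁}^{t} k‖ω‖₂ ≤ 8A'(4π/(3r₀³))^{1/2}((T−t₁)^{1−3β}/(1−3β))^{1/2}√(C‖u(0)‖²₂/ν) → 0` as `t₁ ↑ T` (`β < 1/3`). -/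
theorem argmaxShrinkingCoherenceDoor_of (hD : LocalDepletion) (hE : NearEngineWeighted)
    (hN : ShrinkingDissipationBudget) (hF : TypeISmallFloor) : ArgmaxShrinkingCoherenceDoor := by
  obtain ⟨A, A', hA, hA', hdep⟩ := hD
  obtain ⟨C, hC, hbud⟩ := hN
  refine ⟨A, hA, ?_⟩
  intro ν T t₀ a ε r₀ β hν ht₀ ht₀T ha hε hε' hr₀ hβ hβ3 u p hsol hreg hhyp
  have h13β : 0 < 1 - 3 * β := by linarith
  -- the far-field coefficient of the shrinking ball
  set g : ℝ → ℝ := fun s => (4 * π / (3 * (r₀ * (T - s) ^ β) ^ 3)) ^ (1 / (2 : ℝ)) with hg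
  set k : ℝ → ℝ := fun s => 8 * A' * g s with hk
  have hg0 : ∀ s, s < T → 0 ≤ g s := fun s hs => by
    simp only [hg]
    have hTs : 0 < T - s := sub_pos.2 hs
    exact Real.rpow_nonneg (div_nonneg (by positivity) (by positivity)) _
  have hk0 : ∀ s, s < T → 0 ≤ k s := fun s hs => by
    simp only [hk]; exact mul_nonneg (by positivity) (hg0 s hs)
  have hkc : ∀ t₁ t₂ : ℝ, t₂ < T → ContinuousOn k (Icc t₁ t₂) := by
    intro t₁ t₂ ht₂
    have hτ : ∀ s ∈ Icc t₁ t₂, 0 < T - s := fun s hs => by linarith [hs.2]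
    have h1 : ContinuousOn (fun s : ℝ => T - s) (Icc t₁ t₂) := continuousOn_const.sub continuousOn_id
    have h2 : ContinuousOn (fun s : ℝ => r₀ * (T - s) ^ β) (Icc t₁ t₂) :=
      continuousOn_const.mul (h1.rpow_const fun s hs => Or.inr hβ.le)
    have h2pos : ∀ s ∈ Icc t₁ t₂, 0 < r₀ * (T - s) ^ β := fun s hs =>
      mul_pos hr₀ (Real.rpow_pos_of_pos (hτ s hs) β)
    have h3 : ContinuousOn (fun s : ℝ => 4 * π / (3 * (r₀ * (T - s) ^ β) ^ 3)) (Icc t₁ t₂) :=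
      continuousOn_const.div (continuousOn_const.mul (h2.pow 3)) fun s hs =>
        (mul_pos three_pos (pow_pos (h2pos s hs) 3)).ne'
    have h4 : ContinuousOn g (Icc t₁ t₂) := h3.rpow_const fun s hs => Or.inr (by norm_num)
    exact continuousOn_const.mul h4
  set E₀ : ℝ := ∫ y, ‖u 0 y‖ ^ 2 with hE₀
  set Q : ℝ := Real.sqrt (C * E₀ / ν) with hQ
  have hQ0 : 0 ≤ Q := Real.sqrt_nonneg _
  set K₁ : ℝ := (4 * π / (3 * r₀ ^ 3)) ^ (1 / (2 : ℝ)) with hK₁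
  have hK₁0 : 0 ≤ K₁ := Real.rpow_nonneg (by positivity) _
  -- `W(t₁) = ((T − t₁)^{1−3β}/(1−3β))^{1/2}`, the weight's time budget from `t₁`
  set W : ℝ → ℝ := fun t₁ => ((T - t₁) ^ (1 - 3 * β) / (1 - 3 * β)) ^ (1 / (2 : ℝ)) with hW
  -- ### the barrier on `[t₁, T)` for every slab start `t₁ ∈ [t₀, T)`
  have hbound : ∀ t₁ ∈ Ico t₀ T, ∀ t ∈ Ico t₁ T, ∀ x,
      ‖curl (u t) x‖ ≤ (ε / (T - t) + supVorticity u t₁ * (T - t₁) ^ a * (T - t) ^ (-a)) *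
        Real.exp (8 * A' * K₁ * W t₁ * Q) := by
    intro t₁ ht₁ t ht x
    have hTt₁ : 0 < T - t₁ := sub_pos.2 ht₁.2
    have ht₁0 : 0 ≤ t₁ := ht₀.trans ht₁.1
    set c : ℝ := supVorticity u t₁ * (T - t₁) ^ a with hc
    have hc0 : 0 ≤ c := mul_nonneg (supVorticity_nonneg u t₁) (Real.rpow_nonneg hTt₁.le a)
    have hrate : ∀ s ∈ Ioc t₁ t, ∀ y, IsVorticityArgmax u s y → ε < (T - s) * ‖curl (u s) y‖ →
        ⟪vorticityDirection (curl (u s)) y, fderiv ℝ (u s) y (vorticityDirection (curl (u s)) y)⟫ -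
            ν * frobeniusNormSq (fderiv ℝ (vorticityDirection (curl (u s))) y) ≤
          a / (T - s) + k s * (∫ z, ‖curl (u s) z‖ ^ 2) ^ (1 / (2 : ℝ)) := by
      intro s hs y hy hεs
      have hsT : s < T := hs.2.trans_lt ht.2
      have hTs : 0 < T - s := sub_pos.2 hsT
      have hs0T : s ∈ Ico 0 T := ⟨ht₁0.trans hs.1.le, hsT⟩
      have hst₀ : s ∈ Ico t₀ T := ⟨ht₁.1.trans hs.1.le, hsT⟩
      have hy0 : curl (u s) y ≠ 0 := by
        intro h0; rw [h0, norm_zero, mul_zero] at hεs; exact absurd hεs (not_lt.2 hε.le)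
      have hρ : 0 < r₀ * (T - s) ^ β := mul_pos hr₀ (Real.rpow_pos_of_pos hTs β)
      have hD' := (hdep ν T u p hsol hreg s hs0T y hy0 (r₀ * (T - s) ^ β) hρ).2
      have hh := hhyp s hst₀ y hy hεs
      have := rate_le_of_near_hypothesis (T := T) (ν := ν) (u := u) hTs hy0 hD' hh
      simpa [hk, hg] using this
    have hinit : ∀ y, ‖curl (u t₁) y‖ ≤ ε / (T - t₁) + c * (T - t₁) ^ (-a) := by
      intro y
      have h1 : ‖curl (u t₁) y‖ ≤ supVorticity u t₁ := norm_curl_le_supVorticity hsol hreg ⟨ht₁0, ht₁.2⟩ y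
      have h2 : c * (T - t₁) ^ (-a) = supVorticity u t₁ := by
        rw [hc, mul_assoc, ← Real.rpow_add hTt₁, add_neg_cancel, Real.rpow_zero, mul_one]
      have h3 : 0 ≤ ε / (T - t₁) := (div_pos hε hTt₁).le
      linarith
    have hmain := hE ν T u p hν hsol hreg t₁ t a ε c k ht₁0 ht.1 ht.2 ha.le hε hc0 (hkc t₁ t ht.2)
      (fun s hs => hk0 s (lt_of_le_of_lt hs.2 ht.2)) hrate hinit t ⟨ht.1, le_rfl⟩ x
    -- the exponent: `∫_{t₁}^{t} k‖ω‖₂ = 8A' ∫ g‖ω‖₂ ≤ 8A' K₁ W(t₁) Q`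
    have hI := hbud ν T u p hν hsol hreg t₁ t r₀ β ht₁0 ht.1 ht.2 hr₀ hβ hβ3
    have hexp : Real.exp (∫ r in t₁..t, k r * (∫ y, ‖curl (u r) y‖ ^ 2) ^ (1 / (2 : ℝ))) ≤
        Real.exp (8 * A' * K₁ * W t₁ * Q) := by
      refine Real.exp_le_exp.2 ?_
      have heq : (∫ r in t₁..t, k r * (∫ y, ‖curl (u r) y‖ ^ 2) ^ (1 / (2 : ℝ))) =
          8 * A' * ∫ r in t₁..t, g r * (∫ y, ‖curl (u r) y‖ ^ 2) ^ (1 / (2 : ℝ)) := by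
        rw [← intervalIntegral.integral_const_mul]
        refine intervalIntegral.integral_congr fun r _ => ?_
        simp only [hk]; ring
      rw [heq]
      have h8 : 0 ≤ 8 * A' := by positivity
      calc 8 * A' * ∫ r in t₁..t, g r * (∫ y, ‖curl (u r) y‖ ^ 2) ^ (1 / (2 : ℝ))
            ≤ 8 * A' * (K₁ * W t₁ * Q) := by
              refine mul_le_mul_of_nonneg_left ?_ h8
              have := hI
              simp only [hg, hK₁, hW, hQ, hE₀] at this ⊢
              exact this
        _ = 8 * A' * K₁ * W t₁ * Q := by ring
    have hTt : 0 < T - t := sub_pos.2 ht.2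
    have hB0 : 0 ≤ ε / (T - t) + c * (T - t) ^ (-a) :=
      add_nonneg (div_pos hε hTt).le (mul_nonneg hc0 (Real.rpow_nonneg hTt.le _))
    exact hmain.trans (mul_le_mul_of_nonneg_left hexp hB0)
  -- ### for `η > 0` a slab start with `exp(8A'K₁W(t₁)Q) ≤ 1 + η`
  refine hasSobolevExtensionPast_of_barrier_family hF hν ht₀ ha hε hε' hsol hreg fun η hη => ?_
  set x₀ : ℝ := min 1 (η / 2) with hx₀
  have hx₀0 : 0 < x₀ := lt_min one_pos (by positivity)
  have hx₀1 : x₀ ≤ 1 := min_le_left _ _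
  have hx₀η : x₀ ≤ η / 2 := min_le_right _ _
  set M : ℝ := 8 * A' * K₁ * Q with hM
  have hM0 : 0 ≤ M := by rw [hM]; positivity
  have hM1 : 0 < M + 1 := by positivity
  set y₀ : ℝ := x₀ / (M + 1) with hy₀
  have hy₀0 : 0 < y₀ := div_pos hx₀0 hM1
  -- `d` with `d^{1−3β}/(1−3β) = y₀²`
  set qq : ℝ := y₀ ^ 2 * (1 - 3 * β) with hqq
  have hqq0 : 0 < qq := by positivity
  set d : ℝ := qq ^ (1 / (1 - 3 * β)) with hd
  have hd0 : 0 < d := Real.rpow_pos_of_pos hqq0 _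
  have hdpow : d ^ (1 - 3 * β) = qq := by
    rw [hd, ← Real.rpow_mul hqq0.le, one_div_mul_cancel h13β.ne', Real.rpow_one]
  set t₁ : ℝ := max t₀ (T - d) with ht₁
  have ht₁mem : t₁ ∈ Ico t₀ T := ⟨le_max_left _ _, max_lt ht₀T (by linarith)⟩
  have hTt₁ : 0 < T - t₁ := sub_pos.2 ht₁mem.2
  have hWle : W t₁ ≤ y₀ := by
    have hle : T - t₁ ≤ d := by linarith [le_max_right t₀ (T - d)]
    have h1 : (T - t₁) ^ (1 - 3 * β) ≤ qq := by
      rw [← hdpow]; exact Real.rpow_le_rpow hTt₁.le hle h13β.le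
    have h2 : (T - t₁) ^ (1 - 3 * β) / (1 - 3 * β) ≤ y₀ ^ 2 := by
      rw [div_le_iff₀ h13β]; simpa [hqq] using h1
    have h3 : 0 ≤ (T - t₁) ^ (1 - 3 * β) / (1 - 3 * β) :=
      div_nonneg (Real.rpow_nonneg hTt₁.le _) h13β.le
    calc W t₁ = ((T - t₁) ^ (1 - 3 * β) / (1 - 3 * β)) ^ (1 / (2 : ℝ)) := rfl
      _ ≤ (y₀ ^ 2) ^ (1 / (2 : ℝ)) := Real.rpow_le_rpow h3 h2 (by norm_num)
      _ = y₀ := by rw [← Real.sqrt_eq_rpow, Real.sqrt_sq hy₀0.le]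
  have hW0 : 0 ≤ W t₁ := Real.rpow_nonneg (div_nonneg (Real.rpow_nonneg hTt₁.le _) h13β.le) _
  have hexp1 : M * W t₁ ≤ x₀ := by
    calc M * W t₁ ≤ M * y₀ := mul_le_mul_of_nonneg_left hWle hM0
      _ = x₀ * (M / (M + 1)) := by rw [hy₀]; ring
      _ ≤ x₀ * 1 := mul_le_mul_of_nonneg_left ((div_le_one hM1).2 (by linarith)) hx₀0.le
      _ = x₀ := mul_one _
  have hexp0 : 0 ≤ M * W t₁ := mul_nonneg hM0 hW0
  have hexpη : Real.exp (8 * A' * K₁ * W t₁ * Q) ≤ 1 + η := by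
    have heq : 8 * A' * K₁ * W t₁ * Q = M * W t₁ := by rw [hM]; ring
    rw [heq]
    calc Real.exp (M * W t₁) ≤ 1 + 2 * (M * W t₁) := Literature.NumberTheory.Sieve.exp_le_one_add_two_mul hexp0 (hexp1.trans hx₀1)
      _ ≤ 1 + 2 * x₀ := by linarith
      _ ≤ 1 + η := by linarith
  refine ⟨t₁, ht₁mem, supVorticity u t₁ * (T - t₁) ^ a,
    mul_nonneg (supVorticity_nonneg u t₁) (Real.rpow_nonneg hTt₁.le a), fun t ht x => ?_⟩
  have hTt : 0 < T - t := sub_pos.2 ht.2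
  have hB0 : 0 ≤ ε / (T - t) + supVorticity u t₁ * (T - t₁) ^ a * (T - t) ^ (-a) :=
    add_nonneg (div_pos hε hTt).le (mul_nonneg (mul_nonneg (supVorticity_nonneg u t₁)
      (Real.rpow_nonneg hTt₁.le a)) (Real.rpow_nonneg hTt.le _))
  exact (hbound t₁ ht₁mem t ht x).trans (mul_le_mul_of_nonneg_left hexpη hB0)

/-! ## §6 D♭ by name; the doors modulo the two engine plates -/

/-- plate D♭ DISCHARGED BY NAME (ns-sfl-p1 g5, p649837 `ArgmaxDoors.inner_stretching_le_local`). -/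
theorem localDepletion_holds : LocalDepletion := inner_stretching_le_local

/-- door S36-C♭ modulo E♭ + N♭ (the two S-plates keyed to the LEAD's `ArgmaxDoorsNearEngine` tools). -/
theorem argmaxNearCoherenceDoor_of_engine (hE : NearEngine) (hN : SlabDissipationBudget) :
    ArgmaxNearCoherenceDoor :=
  argmaxNearCoherenceDoor_of localDepletion_holds hE hN typeISmallFloor_holds

/-- door S36-C♯ modulo E♭w + N♭β (the two S-plates keyed to the LEAD's `ArgmaxDoorsNearEngineWeighted` tools). -/
theorem argmaxShrinkingCoherenceDoor_of_engine (hE : NearEngineWeighted) (hN : ShrinkingDissipationBudget) :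
    ArgmaxShrinkingCoherenceDoor :=
  argmaxShrinkingCoherenceDoor_of localDepletion_holds hE hN typeISmallFloor_holds

end Summit.NavierStokesRegularity.NavierStokesRegularity.Theorems.ArgmaxDoors

end
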